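/-
Copyright (c) 2026 the pub-hodgecm-mathlib formalisation cell (harness21).  Prover seat hodgecm-mathlib-K2E1-p11 (g4), Track B ∕ K2-LIT, h413 = `stmt-HodgeConjecture-24833`,
R90-TF section S8 «ContSpec-n½», #2 road (G side), S8 dealer R90-CS-plan (g3) S8-R136 (3) ∕ S8-R151 (1) «NON-ZERO SECTION WITNESS AT A LEVEL», FILE 2 of the census
`R90/S8/CENSUS-ChiSectionPairNonzeroWitness.K2E1-p11-g4.md` f84e71c9c4f7f19b: the FINITE-ADELIC LEVEL SECTION — for every OPEN `Kf ≤ U(2,1)(𝔸_{L⁺,f})` on whose Borel elements the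
pair character `(χ₁, χ₂)` is trivial, the function `Φf := (χ₁,χ₂)_f(b)` on `B(𝔸_f)·Kf`, `0` elsewhere, is a continuous right-`Kf`-invariant left-`(χ₁,χ₂)_f`-equivariant function with
`Φf 1 = 1` — the letter `hΦf*` of ★ p863433 `R90S8ChiSectionPairNonzeroWitnessU3OfLetters` — together with the archimedean∕finite splitting of the Borel pair character (§0).
-/
import Summits.HodgeConjecture.HodgeConjecture.Theorems.R90S8ChiSectionPairNonzeroWitnessU3OfLetters   -- ★ p863433 (this seat): FILE 1 GLUE (letters `hΦa* hΦf* hc`); brings ★ `chiSectionSpacePair`, `firstEntryUnit`, `middleEntryUnitary`, ★ `archPart`∕`finPart`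
import Literature.NumberTheory.Automorphic.IwasawaDecompositionAdelic                                    -- ★ `ofInfinite_mem_standardParabolicGL`, `ofFinite_mem_standardParabolicGL`
import Mathlib.Topology.LocallyConstant.Basic                                                            -- Mathlib `IsLocallyConstant.continuous`
import HarnessLib

/-!
# S8 #2 road (G side) — `R90S8ChiSectionPairFinLevelSectionU3`: the FINITE-ADELIC LEVEL SECTION of the non-zero `(χ₁, χ₂)`-pair-section witness — `Φf(b·k) := χ₁,f(b₀₀)·χ₂,f(b₁₁)` on
# `B(𝔸_f)·Kf`, `0` off it, for an OPEN level `Kf ≤ U(2,1)(𝔸_{L⁺,f})` with `(χ₁,χ₂) = 1` on `B(𝔸_f) ∩ Kf`: continuous, right-`Kf`-invariant, left-equivariant, `Φf 1 = 1`; and the splitting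
# `(χ₁,χ₂)(b) = (χ₁,χ₂)(b_∞)·(χ₁,χ₂)(b_f)` of the Borel pair character

Track B ∕ K2-LIT, crux h413 = `stmt-HodgeConjecture-24833`, route of record `HCCMUnconditional`; cell `hodgecm-mathlib`, R90-TF programme, section S8 «ContSpec-n½», socket (V)
`sock_S8_res_midBlock_ne_bot` (`Lines/R90_S8_ResidualSpectrumU3B.lean` :300), discharge-table row (i) (non-zero section witness; K2E2-p12 (g9) 3df908fcf11ad296).  THEOREMS ONLY (no `def`, no
`instance`, no `notation`, no named-fact hypothesis, no `sorry`; default heartbeats); lane `--supports stmt-HodgeConjecture-24833 --as helper` (count-neutral).  CLOSES NO SOCKET: it pays the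
finite letters `hΦfc hΦfB hΦfK hΦf1` of ★ p863433 `exists_chiSectionPair_continuous_apply_one_ne_zero_of_letters` (FILE 1) at every OPEN level `Kf` carrying the CONDUCTOR hypothesis `hKχ`
(«`χ₁(k₀₀)·χ₂(k₁₁) = 1` for Borel `k ∈ Kf`» — satisfied by the principal congruence level below the conductors of `χ₁`, `χ₂`; the choice of such a `Kf` is left to the assembly), and the
multiplier identity `hc` of FILE 1 with `ca b := (χ₁,χ₂)(b_∞)`, `cf b := (χ₁,χ₂)(b_f)` (§0); the archimedean letters `hΦa*` are FILE 3 (census road (A)).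

THE MATHEMATICS ([BorelJacquet1979, §4.1]; [MoeglinWaldspurger1995, I.2.17]; [Casselman1973, §1 (new vectors: level = conductor)]).  §0: for `b ∈ B(𝔸)` both components `b_∞ = (b_∞, 1)` and
`b_f = (1, b_f)` are again in `B(𝔸)` (upper-triangularity is read entrywise, ★ `ofInfinite∕ofFinite_mem_standardParabolicGL`), `b = b_∞·b_f` (★ `archToAdelic_mul_finAdelicToAdelic`), and
`b ↦ (b₀₀, b₁₁)` is multiplicative (★ `firstEntryUnit_mul`, ★ `middleEntryUnitary_mul`), so `χ₁(b₀₀)χ₂(b₁₁) = [χ₁χ₂](b_∞)·[χ₁χ₂](b_f)`.  §1: on `G_f := U(2,1)(𝔸_{L⁺,f})` let `B_f := ι_f⁻¹ B(𝔸)`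
and `θ(u) := χ₁((ι_f u)₀₀)·χ₂((ι_f u)₁₁)` for `u ∈ B_f` — a character of `B_f`.  If `θ = 1` on `B_f ∩ Kf` (`hKχ`), then `Φf(u) := θ(b)` for `u = b·k` (`b ∈ B_f`, `k ∈ Kf`), `:= 0` for `u ∉ B_f·Kf`,
is WELL DEFINED (`b·k = b′·k′ ⇒ b′⁻¹b = k′k⁻¹ ∈ B_f ∩ Kf ⇒ θ(b) = θ(b′)`), right-`Kf`-invariant (`B_f·Kf` is right-`Kf`-stable), left-`θ`-equivariant under `B_f ∋ b_f` for every adelic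
Borel `b` (`B_f·Kf` and its complement are left-`B_f`-stable), `Φf(1) = θ(1) = 1`, and CONTINUOUS because it is LOCALLY CONSTANT: `Kf` is open, so `u·Kf` is an open neighbourhood of `u` on
which `Φf ≡ Φf(u)` (Mathlib `isOpenMap_mul_left`, `IsLocallyConstant.continuous`) — no clopen bookkeeping needed.
* §0 `archToAdelic_archPart_mem_borelAdelic`, `finAdelicToAdelic_finPart_mem_borelAdelic`, `firstEntryUnit_congr`, `middleEntryUnitary_congr`, **`borelPairChar_eq_arch_mul_fin`**
  (the splitting = FILE 1's `hc` for `ca := (χ₁,χ₂)(·_∞)`, `cf := (χ₁,χ₂)(·_f)`).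
* §1 **`exists_finLevelSection`** — `∃ Φf : G_f → ℂ, Continuous Φf ∧ (∀ b ∈ B(𝔸), ∀ u, Φf (b_f·u) = (χ₁,χ₂)(b_f)·Φf u) ∧ (∀ u, ∀ k ∈ Kf, Φf (u·k) = Φf u) ∧ Φf 1 = 1`, for every OPEN `Kf`
  with `hKχ` — the four finite letters of FILE 1, by name.
HONEST LABEL: HC_CM is proved only modulo the 7 printed citations (2 remaining named inputs: hLiu418 = `stmt-HodgeConjecture-24832`, h413 = `stmt-HodgeConjecture-24833`) until rung 0
closes; REL ≠ ★ ≠ BUILT; this file asserts no named fact and closes no socket — (V)(i) stays OPEN modulo FILE 3 (the archimedean section) and the choice of a conductor level `Kf`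
(`hKχ`), and (V) itself is coupled to `hA32` (J-S8-∞); count-neutral.

## References
* [BorelJacquet1979] A. Borel, H. Jacquet, *Automorphic forms and automorphic representations*, Corvallis PSPM 33.1 (1979), §4.1.
* [MoeglinWaldspurger1995] C. Mœglin, J.-L. Waldspurger, *Spectral Decomposition and Eisenstein Series* (1995), I.2.17.
* [Casselman1973] W. Casselman, *On some results of Atkin and Lehner*, Math. Ann. 201 (1973), §1.
-/

set_option autoImplicit false
set_option linter.dupNamespace false  -- the mandated namespace `…HodgeConjecture.HodgeConjecture.R90.S8` (LEAD #1 L1) repeats the summit's segment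

noncomputable section

open NumberField Topology Filter
open Literature.NumberTheory.Automorphic Literature.NumberTheory.Automorphic.UnitaryGroup Literature.NumberTheory.GaloisRepresentations AdelicGroupData
open Literature.NumberTheory.Automorphic.Arthur2013.Leaves.TECR
open Summit.HodgeConjecture.HodgeConjecture.Cruxes.H413.K2E1CharacterEisensteinU2Defs
open Summit.HodgeConjecture.HodgeConjecture.Cruxes.H413.K2E1CharacterEisensteinU3PairDefs
open Summit.HodgeConjecture.HodgeConjecture.Cruxes.H413.K2E1ChiSectionSpaceU3PairDefs

namespace Summit.HodgeConjecture.HodgeConjecture.R90.S8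

section Components

variable (L : Type) [Field L] [NumberField L] [IsCMField L]

/-! ## §0 The archimedean and finite components of an adelic Borel element; the splitting of the Borel pair character -/

/-- **`b ∈ B(𝔸) ⇒ b_∞ = (b_∞, 1) ∈ B(𝔸)`**: the archimedean component of an upper-triangular adelic matrix is upper triangular (entrywise; ★ `ofInfinite_mem_standardParabolicGL`).
[cite: BorelJacquet1979, §4.1] -/
theorem archToAdelic_archPart_mem_borelAdelic {b : (quasiSplit (↥(maximalRealSubfield L)) L (IsCMField.complexConj L) 3).Adelic}
    (hb : b ∈ borelAdelic (↥(maximalRealSubfield L)) L (IsCMField.complexConj L) 3) :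
    archToAdelic (↥(maximalRealSubfield L)) L (IsCMField.complexConj L) 3 ((StdForm.antidiagonal 3).over L)
        (archPart (↥(maximalRealSubfield L)) L (IsCMField.complexConj L) 3 ((StdForm.antidiagonal 3).over L) b) ∈
      borelAdelic (↥(maximalRealSubfield L)) L (IsCMField.complexConj L) 3 := by
  have hω : ((adelicVal (↥(maximalRealSubfield L)) L (IsCMField.complexConj L) 3 ((StdForm.antidiagonal 3).over L) b : GL (Fin 3) (AdeleRing (𝓞 L) L)) :
      Matrix (Fin 3) (Fin 3) (AdeleRing (𝓞 L) L)).BlockTriangular id := (mem_borelAdelic_iff b).1 hb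
  show adelicVal (↥(maximalRealSubfield L)) L (IsCMField.complexConj L) 3 ((StdForm.antidiagonal 3).over L)
      (archToAdelic (↥(maximalRealSubfield L)) L (IsCMField.complexConj L) 3 ((StdForm.antidiagonal 3).over L)
        (archPart (↥(maximalRealSubfield L)) L (IsCMField.complexConj L) 3 ((StdForm.antidiagonal 3).over L) b)) ∈
    standardParabolicGL (AdeleRing (𝓞 L) L) (id : Fin 3 → Fin 3)
  rw [adelicVal_archToAdelic, coe_archPart]
  refine ofInfinite_mem_standardParabolicGL 3 L (fun i j hij => ?_)
  show InfiniteAdeleRing.ringEquiv_mixedSpace L ((((adelicVal (↥(maximalRealSubfield L)) L (IsCMField.complexConj L) 3 ((StdForm.antidiagonal 3).over L) b :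
      GL (Fin 3) (AdeleRing (𝓞 L) L)) : Matrix (Fin 3) (Fin 3) (AdeleRing (𝓞 L) L)) i j).1) = 0
  rw [hω hij]
  exact map_zero _

/-- **`b ∈ B(𝔸) ⇒ b_f = (1, b_f) ∈ B(𝔸)`** (entrywise; ★ `ofFinite_mem_standardParabolicGL`). [cite: BorelJacquet1979, §4.1] -/
theorem finAdelicToAdelic_finPart_mem_borelAdelic {b : (quasiSplit (↥(maximalRealSubfield L)) L (IsCMField.complexConj L) 3).Adelic}
    (hb : b ∈ borelAdelic (↥(maximalRealSubfield L)) L (IsCMField.complexConj L) 3) :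
    finAdelicToAdelic (↥(maximalRealSubfield L)) L (IsCMField.complexConj L) 3 ((StdForm.antidiagonal 3).over L)
        (finPart (↥(maximalRealSubfield L)) L (IsCMField.complexConj L) 3 ((StdForm.antidiagonal 3).over L) b) ∈
      borelAdelic (↥(maximalRealSubfield L)) L (IsCMField.complexConj L) 3 := by
  have hω : ((adelicVal (↥(maximalRealSubfield L)) L (IsCMField.complexConj L) 3 ((StdForm.antidiagonal 3).over L) b : GL (Fin 3) (AdeleRing (𝓞 L) L)) :
      Matrix (Fin 3) (Fin 3) (AdeleRing (𝓞 L) L)).BlockTriangular id := (mem_borelAdelic_iff b).1 hb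
  show adelicVal (↥(maximalRealSubfield L)) L (IsCMField.complexConj L) 3 ((StdForm.antidiagonal 3).over L)
      (finAdelicToAdelic (↥(maximalRealSubfield L)) L (IsCMField.complexConj L) 3 ((StdForm.antidiagonal 3).over L)
        (finPart (↥(maximalRealSubfield L)) L (IsCMField.complexConj L) 3 ((StdForm.antidiagonal 3).over L) b)) ∈
    standardParabolicGL (AdeleRing (𝓞 L) L) (id : Fin 3 → Fin 3)
  rw [adelicVal_finAdelicToAdelic, coe_finPart]
  refine ofFinite_mem_standardParabolicGL 3 L (fun i j hij => ?_)
  show ((((adelicVal (↥(maximalRealSubfield L)) L (IsCMField.complexConj L) 3 ((StdForm.antidiagonal 3).over L) b :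
      GL (Fin 3) (AdeleRing (𝓞 L) L)) : Matrix (Fin 3) (Fin 3) (AdeleRing (𝓞 L) L)) i j).2) = 0
  rw [hω hij]
  rfl

/-- `b ↦ b₀₀` does not depend on the membership proof, and respects `b = b′`. [folklore] -/
theorem firstEntryUnit_congr {b b' : (quasiSplit (↥(maximalRealSubfield L)) L (IsCMField.complexConj L) 3).Adelic} (h : b = b')
    (hb : b ∈ borelAdelic (↥(maximalRealSubfield L)) L (IsCMField.complexConj L) 3) (hb' : b' ∈ borelAdelic (↥(maximalRealSubfield L)) L (IsCMField.complexConj L) 3) :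
    firstEntryUnit hb = firstEntryUnit hb' := by
  subst h; rfl

/-- `b ↦ b₁₁` does not depend on the membership proof, and respects `b = b′`. [folklore] -/
theorem middleEntryUnitary_congr {b b' : (quasiSplit (↥(maximalRealSubfield L)) L (IsCMField.complexConj L) 3).Adelic} (h : b = b')
    (hb : b ∈ borelAdelic (↥(maximalRealSubfield L)) L (IsCMField.complexConj L) 3) (hb' : b' ∈ borelAdelic (↥(maximalRealSubfield L)) L (IsCMField.complexConj L) 3) :
    middleEntryUnitary hb = middleEntryUnitary hb' := by
  subst h; rfl

/-- **THE SPLITTING OF THE BOREL PAIR CHARACTER**: `χ₁(b₀₀)·χ₂(b₁₁) = [χ₁(·₀₀)χ₂(·₁₁)](b_∞) · [χ₁(·₀₀)χ₂(·₁₁)](b_f)` for `b ∈ B(𝔸)` (`b = b_∞ b_f` ★ `archToAdelic_mul_finAdelicToAdelic`, both factors in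
`B(𝔸)` by §0, multiplicativity ★ `firstEntryUnit_mul` ∕ ★ `middleEntryUnitary_mul`) — FILE 1's multiplier identity `hc` with `ca := (χ₁,χ₂)(·_∞)`, `cf := (χ₁,χ₂)(·_f)`.
[cite: BorelJacquet1979, §4.1] [cite: MoeglinWaldspurger1995, I.2.17] -/
theorem borelPairChar_eq_arch_mul_fin (χ₁ : HeckeCharacter L) (χ₂ : ↥(TorusDict.torus (IsCMField.complexConj L)) →ₜ* ℂˣ)
    {b : (quasiSplit (↥(maximalRealSubfield L)) L (IsCMField.complexConj L) 3).Adelic} (hb : b ∈ borelAdelic (↥(maximalRealSubfield L)) L (IsCMField.complexConj L) 3) :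
    ((χ₁ (firstEntryUnit hb) : ℂˣ) : ℂ) * ((χ₂ (middleEntryUnitary hb) : ℂˣ) : ℂ) =
      (((χ₁ (firstEntryUnit (archToAdelic_archPart_mem_borelAdelic L hb)) : ℂˣ) : ℂ) * ((χ₂ (middleEntryUnitary (archToAdelic_archPart_mem_borelAdelic L hb)) : ℂˣ) : ℂ)) *
        (((χ₁ (firstEntryUnit (finAdelicToAdelic_finPart_mem_borelAdelic L hb)) : ℂˣ) : ℂ) * ((χ₂ (middleEntryUnitary (finAdelicToAdelic_finPart_mem_borelAdelic L hb)) : ℂˣ) : ℂ)) := by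
  have hprod := archToAdelic_mul_finAdelicToAdelic (↥(maximalRealSubfield L)) L (IsCMField.complexConj L) 3 ((StdForm.antidiagonal 3).over L) b
  rw [firstEntryUnit_congr L hprod.symm hb (Subgroup.mul_mem _ (archToAdelic_archPart_mem_borelAdelic L hb) (finAdelicToAdelic_finPart_mem_borelAdelic L hb)),
    middleEntryUnitary_congr L hprod.symm hb (Subgroup.mul_mem _ (archToAdelic_archPart_mem_borelAdelic L hb) (finAdelicToAdelic_finPart_mem_borelAdelic L hb)),
    firstEntryUnit_mul (archToAdelic_archPart_mem_borelAdelic L hb) (finAdelicToAdelic_finPart_mem_borelAdelic L hb),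
    middleEntryUnitary_mul (archToAdelic_archPart_mem_borelAdelic L hb) (finAdelicToAdelic_finPart_mem_borelAdelic L hb), map_mul, map_mul, Units.val_mul, Units.val_mul]
  ring

end Components

/-! ## §1 The finite-adelic level section -/

section FinLevel

variable (L : Type) [Field L] [NumberField L] [IsCMField L]

/-- **THE FINITE-ADELIC LEVEL SECTION**: for an OPEN `Kf ≤ G_f = U(2,1)(𝔸_{L⁺,f})` on whose Borel elements the pair character is trivial (`hKχ`: `χ₁((ι_f k)₀₀)·χ₂((ι_f k)₁₁) = 1` for
`k ∈ Kf` with `ι_f k ∈ B(𝔸)` — a CONDUCTOR condition, satisfied below the conductors of `χ₁, χ₂`), there is `Φf : G_f → ℂ` — namely `Φf(b·k) := χ₁((ι_f b)₀₀)χ₂((ι_f b)₁₁)` on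
`B_f·Kf`, `0` off it — which is CONTINUOUS (locally constant: constant on the open cosets `u·Kf`), LEFT-EQUIVARIANT `Φf(b_f·u) = [χ₁χ₂](b_f)·Φf(u)` for every adelic Borel `b`
(`b_f = (1, b_f) ∈ B(𝔸)` §0), RIGHT-`Kf`-INVARIANT, and normalised `Φf 1 = 1`: the letters `hΦfc hΦfB hΦfK hΦf1` of ★ p863433 (FILE 1) with `cf b := [χ₁χ₂](b_f)`.
[cite: BorelJacquet1979, §4.1] [cite: MoeglinWaldspurger1995, I.2.17] [cite: Casselman1973, §1] -/
theorem exists_finLevelSection (χ₁ : HeckeCharacter L) (χ₂ : ↥(TorusDict.torus (IsCMField.complexConj L)) →ₜ* ℂˣ)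
    (Kf : Subgroup ↥(finAdelic (↥(maximalRealSubfield L)) L (IsCMField.complexConj L) 3 ((StdForm.antidiagonal 3).over L)))
    (hKo : IsOpen ((Kf : Subgroup ↥(finAdelic (↥(maximalRealSubfield L)) L (IsCMField.complexConj L) 3 ((StdForm.antidiagonal 3).over L))) : Set ↥(finAdelic (↥(maximalRealSubfield L)) L (IsCMField.complexConj L) 3 ((StdForm.antidiagonal 3).over L))))
    (hKχ : ∀ k ∈ Kf, ∀ (hk : finAdelicToAdelic (↥(maximalRealSubfield L)) L (IsCMField.complexConj L) 3 ((StdForm.antidiagonal 3).over L) k ∈ borelAdelic (↥(maximalRealSubfield L)) L (IsCMField.complexConj L) 3),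
      ((χ₁ (firstEntryUnit hk) : ℂˣ) : ℂ) * ((χ₂ (middleEntryUnitary hk) : ℂˣ) : ℂ) = 1) :
    ∃ Φf : ↥(finAdelic (↥(maximalRealSubfield L)) L (IsCMField.complexConj L) 3 ((StdForm.antidiagonal 3).over L)) → ℂ,
      Continuous Φf ∧
      (∀ (b : (quasiSplit (↥(maximalRealSubfield L)) L (IsCMField.complexConj L) 3).Adelic) (hb : b ∈ borelAdelic (↥(maximalRealSubfield L)) L (IsCMField.complexConj L) 3)
          (u : ↥(finAdelic (↥(maximalRealSubfield L)) L (IsCMField.complexConj L) 3 ((StdForm.antidiagonal 3).over L))),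
        Φf (finPart (↥(maximalRealSubfield L)) L (IsCMField.complexConj L) 3 ((StdForm.antidiagonal 3).over L) b * u) =
          (((χ₁ (firstEntryUnit (finAdelicToAdelic_finPart_mem_borelAdelic L hb)) : ℂˣ) : ℂ) * ((χ₂ (middleEntryUnitary (finAdelicToAdelic_finPart_mem_borelAdelic L hb)) : ℂˣ) : ℂ)) * Φf u) ∧
      (∀ u, ∀ k ∈ Kf, Φf (u * k) = Φf u) ∧ Φf 1 = 1 := by
  classical
  -- the finite Borel character `θ` (as a function on `G_f`, meaningful on `B_f := ι_f⁻¹ B(𝔸)`)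
  set ιf := finAdelicToAdelic (↥(maximalRealSubfield L)) L (IsCMField.complexConj L) 3 ((StdForm.antidiagonal 3).over L) with hιf
  set θ : ↥(finAdelic (↥(maximalRealSubfield L)) L (IsCMField.complexConj L) 3 ((StdForm.antidiagonal 3).over L)) → ℂ := fun u =>
    if hu : ιf u ∈ borelAdelic (↥(maximalRealSubfield L)) L (IsCMField.complexConj L) 3 then ((χ₁ (firstEntryUnit hu) : ℂˣ) : ℂ) * ((χ₂ (middleEntryUnitary hu) : ℂˣ) : ℂ) else 0 with hθ
  have hθ_of : ∀ {u} (hu : ιf u ∈ borelAdelic (↥(maximalRealSubfield L)) L (IsCMField.complexConj L) 3),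
      θ u = ((χ₁ (firstEntryUnit hu) : ℂˣ) : ℂ) * ((χ₂ (middleEntryUnitary hu) : ℂˣ) : ℂ) := fun hu => by
    simp only [hθ, dif_pos hu]
  -- `θ` is multiplicative on `B_f` and `θ(1) = 1`
  have hθ_mul : ∀ {u v} (hu : ιf u ∈ borelAdelic (↥(maximalRealSubfield L)) L (IsCMField.complexConj L) 3) (hv : ιf v ∈ borelAdelic (↥(maximalRealSubfield L)) L (IsCMField.complexConj L) 3),
      θ (u * v) = θ u * θ v := fun {u v} hu hv => by
    have huv : ιf (u * v) ∈ borelAdelic (↥(maximalRealSubfield L)) L (IsCMField.complexConj L) 3 := by rw [map_mul]; exact Subgroup.mul_mem _ hu hv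
    rw [hθ_of huv, hθ_of hu, hθ_of hv, firstEntryUnit_congr L (map_mul ιf u v) huv (Subgroup.mul_mem _ hu hv), middleEntryUnitary_congr L (map_mul ιf u v) huv (Subgroup.mul_mem _ hu hv),
      firstEntryUnit_mul hu hv, middleEntryUnitary_mul hu hv, map_mul, map_mul, Units.val_mul, Units.val_mul]
    ring
  have h1B : ιf 1 ∈ borelAdelic (↥(maximalRealSubfield L)) L (IsCMField.complexConj L) 3 := by rw [map_one]; exact Subgroup.one_mem _
  have hθ_one : θ 1 = 1 := by
    rw [hθ_of h1B, firstEntryUnit_congr L (map_one ιf) h1B (Subgroup.one_mem _), middleEntryUnitary_congr L (map_one ιf) h1B (Subgroup.one_mem _), firstEntryUnit_one, middleEntryUnitary_one,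
      map_one, map_one, Units.val_one, one_mul]
  -- well-definedness of `θ(b)` on the coset space `B_f·Kf / Kf`: `b k = b′ k′ ⇒ θ b = θ b′`
  have hwd : ∀ {b b' k k'} (hb : ιf b ∈ borelAdelic (↥(maximalRealSubfield L)) L (IsCMField.complexConj L) 3) (hb' : ιf b' ∈ borelAdelic (↥(maximalRealSubfield L)) L (IsCMField.complexConj L) 3),
      k ∈ Kf → k' ∈ Kf → b * k = b' * k' → θ b = θ b' := fun {b b' k k'} hb hb' hk hk' heq => by
    -- `m := b′⁻¹ b = k′ k⁻¹ ∈ B_f ∩ Kf`, `θ m = 1`, `b = b′ m`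
    have hm : b'⁻¹ * b = k' * k⁻¹ := by
      rw [inv_mul_eq_iff_eq_mul, ← mul_assoc, ← heq, mul_assoc, mul_inv_cancel, mul_one]
    have hmK : b'⁻¹ * b ∈ Kf := by rw [hm]; exact Kf.mul_mem hk' (Kf.inv_mem hk)
    have hmB : ιf (b'⁻¹ * b) ∈ borelAdelic (↥(maximalRealSubfield L)) L (IsCMField.complexConj L) 3 := by
      rw [map_mul, map_inv]; exact Subgroup.mul_mem _ (Subgroup.inv_mem _ hb') hb
    have hθm : θ (b'⁻¹ * b) = 1 := by rw [hθ_of hmB]; exact hKχ _ hmK hmB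
    calc θ b = θ (b' * (b'⁻¹ * b)) := by rw [mul_inv_cancel_left]
      _ = θ b' := by rw [hθ_mul hb' hmB, hθm, mul_one]
  -- the section
  set Φf : ↥(finAdelic (↥(maximalRealSubfield L)) L (IsCMField.complexConj L) 3 ((StdForm.antidiagonal 3).over L)) → ℂ := fun u =>
    if h : ∃ b k, ιf b ∈ borelAdelic (↥(maximalRealSubfield L)) L (IsCMField.complexConj L) 3 ∧ k ∈ Kf ∧ u = b * k then θ h.choose else 0 with hΦf
  -- its value on `B_f·Kf` and off it
  have hval : ∀ {u b k} (hb : ιf b ∈ borelAdelic (↥(maximalRealSubfield L)) L (IsCMField.complexConj L) 3), k ∈ Kf → u = b * k → Φf u = θ b := fun {u b k} hb hk hu => by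
    have h : ∃ b k, ιf b ∈ borelAdelic (↥(maximalRealSubfield L)) L (IsCMField.complexConj L) 3 ∧ k ∈ Kf ∧ u = b * k := ⟨b, k, hb, hk, hu⟩
    have hΦu : Φf u = θ h.choose := by simp only [hΦf, dif_pos h]
    obtain ⟨k₀, hb₀, hk₀, hu₀⟩ := h.choose_spec
    rw [hΦu]
    exact hwd hb₀ hb hk₀ hk (hu₀.symm.trans hu)
  have hval0 : ∀ {u}, (¬ ∃ b k, ιf b ∈ borelAdelic (↥(maximalRealSubfield L)) L (IsCMField.complexConj L) 3 ∧ k ∈ Kf ∧ u = b * k) → Φf u = 0 := fun h => by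
    simp only [hΦf, dif_neg h]
  -- right `Kf`-invariance
  have hK : ∀ u, ∀ k ∈ Kf, Φf (u * k) = Φf u := by
    intro u k hk
    by_cases h : ∃ b k', ιf b ∈ borelAdelic (↥(maximalRealSubfield L)) L (IsCMField.complexConj L) 3 ∧ k' ∈ Kf ∧ u = b * k'
    · obtain ⟨b, k', hb, hk', rfl⟩ := h
      rw [hval hb hk' rfl, hval hb (Kf.mul_mem hk' hk) (mul_assoc b k' k)]
    · have h' : ¬ ∃ b k', ιf b ∈ borelAdelic (↥(maximalRealSubfield L)) L (IsCMField.complexConj L) 3 ∧ k' ∈ Kf ∧ u * k = b * k' := by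
        rintro ⟨b, k', hb, hk', hbk⟩
        exact h ⟨b, k' * k⁻¹, hb, Kf.mul_mem hk' (Kf.inv_mem hk), by rw [← mul_assoc, ← hbk, mul_inv_cancel_right]⟩
      rw [hval0 h, hval0 h']
  refine ⟨Φf, ?_, fun b hb u => ?_, hK, ?_⟩
  · -- continuity: `Φf` is locally constant (constant on the open cosets `u·Kf`)
    refine IsLocallyConstant.continuous ((IsLocallyConstant.iff_eventually_eq Φf).2 fun u => ?_)
    have hopen : IsOpen ((fun k => u * k) '' ((Kf : Subgroup ↥(finAdelic (↥(maximalRealSubfield L)) L (IsCMField.complexConj L) 3 ((StdForm.antidiagonal 3).over L))) :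
        Set ↥(finAdelic (↥(maximalRealSubfield L)) L (IsCMField.complexConj L) 3 ((StdForm.antidiagonal 3).over L)))) := isOpenMap_mul_left u _ hKo
    filter_upwards [hopen.mem_nhds ⟨1, Kf.one_mem, mul_one u⟩] with y hy
    obtain ⟨k, hk, rfl⟩ := hy
    exact hK u k hk
  · -- left equivariance under `b_f` for an adelic Borel `b`
    have hβ : ιf (finPart (↥(maximalRealSubfield L)) L (IsCMField.complexConj L) 3 ((StdForm.antidiagonal 3).over L) b) ∈ borelAdelic (↥(maximalRealSubfield L)) L (IsCMField.complexConj L) 3 :=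
      finAdelicToAdelic_finPart_mem_borelAdelic L hb
    by_cases h : ∃ b₁ k, ιf b₁ ∈ borelAdelic (↥(maximalRealSubfield L)) L (IsCMField.complexConj L) 3 ∧ k ∈ Kf ∧ u = b₁ * k
    · obtain ⟨b₁, k, hb₁, hk, rfl⟩ := h
      have hβb₁ : ιf (finPart (↥(maximalRealSubfield L)) L (IsCMField.complexConj L) 3 ((StdForm.antidiagonal 3).over L) b * b₁) ∈ borelAdelic (↥(maximalRealSubfield L)) L (IsCMField.complexConj L) 3 := by
        rw [map_mul]; exact Subgroup.mul_mem _ hβ hb₁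
      rw [hval hb₁ hk rfl, hval hβb₁ hk (mul_assoc _ b₁ k).symm, hθ_mul hβ hb₁, hθ_of hβ]
    · have h' : ¬ ∃ b₁ k, ιf b₁ ∈ borelAdelic (↥(maximalRealSubfield L)) L (IsCMField.complexConj L) 3 ∧ k ∈ Kf ∧
          finPart (↥(maximalRealSubfield L)) L (IsCMField.complexConj L) 3 ((StdForm.antidiagonal 3).over L) b * u = b₁ * k := by
        rintro ⟨b₁, k, hb₁, hk, hbk⟩
        refine h ⟨(finPart (↥(maximalRealSubfield L)) L (IsCMField.complexConj L) 3 ((StdForm.antidiagonal 3).over L) b)⁻¹ * b₁, k, ?_, hk, ?_⟩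
        · rw [map_mul, map_inv]; exact Subgroup.mul_mem _ (Subgroup.inv_mem _ hβ) hb₁
        · rw [mul_assoc, ← hbk, inv_mul_cancel_left]
      rw [hval0 h, hval0 h', mul_zero]
  · -- normalisation
    rw [hval h1B Kf.one_mem (mul_one _).symm, hθ_one]

end FinLevel

end Summit.HodgeConjecture.HodgeConjecture.R90.S8

end
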